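import Literature.Geometry.Lorentzian.KerrPhotonShellTurningPoints
import HarnessLib

/-!
# Crux `GapExhaustion` (stmt-FinalStateConjecture-10808), line `photon-shell-pseudoconvexity`:
# stub S1 `stub_kerrShellTurning` — the photon shell is where null turning points change type

Route `BartnikGapSettling`; helper (`--supports stmt-FinalStateConjecture-10808`) landing the
registered stub `stub_kerrShellTurning` of the parked line skeleton
`Cruxes/GapExhaustion/Lines/photon_shell_pseudoconvexity.lean` (§1, "Stub 1 (ALG)"), stated over
the Literature vocabulary of `Literature/Geometry/Lorentzian/KerrNullRadialPotential.lean` and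
`KerrPhotonShellTurningPoints.lean` (the skeleton's local `nullRadialPotential`,
`ThetaAdmissible`, `rPhMinus M a = Kerr.photonOrbitRadius M |a|`,
`rPhPlus M a = Kerr.photonOrbitRadius M (−|a|)`, `PericentresBeyond`, `ApocentresBelow` are
these, verbatim): on the compact label window `m₀ ≤ M ≤ m₀⁻¹`, `|a| ≤ χM` (`χ < 1`) there is a
uniform `ε > 0` with `r₊ + 2ε ≤ r_ph⁺(M, a)`, every Θ-admissible root `c > r_ph⁻(M, a)` of the
null radial Carter potential is a pericentre (`R′(c) > 0`) and every root with
`r₊ < c < r_ph⁺(M, a)` is an apocentre (`R′(c) < 0`). All the mathematics is in the two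
Literature files (fully proved); here `ε := m₀(1 − χ²)/6` for `χ ≥ 0` (the Literature gap is
`M(1 − χ²)/3 ≥ 2ε`), and `ε := 1` in the vacuous case `χ < 0`.
-/

noncomputable section

-- D-0017: single-problem summit, `Summit.<S>.<S>.…` by design (cf. lakefile `weak.linter.dupNamespace`).
set_option linter.dupNamespace false

namespace Summit.FinalStateConjecture.FinalStateConjecture.Theorems

open Literature.Geometry.Lorentzian

/-- **Stub S1 of line `photon-shell-pseudoconvexity` (crux `GapExhaustion`,
stmt-FinalStateConjecture-10808) — the photon shell is exactly where null turning points change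
type, with a uniform gap above the horizon.** For `χ < 1`, `0 < m₀` there is `ε > 0` such that
for every label `m₀ ≤ M ≤ m₀⁻¹`, `|a| ≤ χM`: `r₊(M, a) + 2ε ≤ r_ph⁺ = Kerr.photonOrbitRadius M (−|a|)`;
every non-trivial Θ-admissible root `c > r_ph⁻ = Kerr.photonOrbitRadius M |a|` of the null radial
Carter potential has `R′(c) > 0`; every such root with `r₊ < c < r_ph⁺` has `R′(c) < 0`.
From `Kerr.rPlus_add_le_photonOrbitRadius_neg`,
`Kerr.deriv_nullRadialPotential_pos_of_photonOrbitRadius_lt`,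
`Kerr.deriv_nullRadialPotential_neg_of_lt_photonOrbitRadius_neg`. -/
theorem stub_kerrShellTurning :
    ∀ (χ m₀ : ℝ), χ < 1 → 0 < m₀ → ∃ ε : ℝ, 0 < ε ∧
      ∀ M a : ℝ, m₀ ≤ M → M ≤ m₀⁻¹ → |a| ≤ χ * M →
        Kerr.rPlus M a + 2 * ε ≤ Kerr.photonOrbitRadius M (-|a|) ∧
        (∀ E L Q c : ℝ, Kerr.photonOrbitRadius M |a| < c → Kerr.NullThetaAdmissible a E L Q →
          (E ≠ 0 ∨ L ≠ 0 ∨ Q ≠ 0) → Kerr.nullRadialPotential M a E L Q c = 0 →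
          0 < deriv (Kerr.nullRadialPotential M a E L Q) c) ∧
        (∀ E L Q c : ℝ, Kerr.rPlus M a < c → c < Kerr.photonOrbitRadius M (-|a|) →
          Kerr.NullThetaAdmissible a E L Q → (E ≠ 0 ∨ L ≠ 0 ∨ Q ≠ 0) →
          Kerr.nullRadialPotential M a E L Q c = 0 →
          deriv (Kerr.nullRadialPotential M a E L Q) c < 0) := by
  intro χ m₀ hχ hm₀
  by_cases hχ0 : 0 ≤ χ
  · have hχ2 : 0 < 1 - χ ^ 2 := by nlinarith
    refine ⟨m₀ * (1 - χ ^ 2) / 6, div_pos (mul_pos hm₀ hχ2) (by norm_num), ?_⟩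
    intro M a hM hM' ha
    have hMpos : 0 < M := hm₀.trans_le hM
    have haM : |a| < M := by nlinarith [abs_nonneg a]
    refine ⟨?_, fun E L Q c hc hadm hne hroot =>
        Kerr.deriv_nullRadialPotential_pos_of_photonOrbitRadius_lt hMpos haM hc hadm hne hroot,
      fun E L Q c hc₁ hc₂ hadm hne hroot =>
        Kerr.deriv_nullRadialPotential_neg_of_lt_photonOrbitRadius_neg hMpos haM hc₁ hc₂ hadm hne
          hroot⟩
    have hgap := Kerr.rPlus_add_le_photonOrbitRadius_neg hMpos hχ0 hχ ha
    have : m₀ * (1 - χ ^ 2) ≤ M * (1 - χ ^ 2) := mul_le_mul_of_nonneg_right hM hχ2.le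
    linarith
  · refine ⟨1, one_pos, ?_⟩
    intro M a hM _ ha
    exfalso
    have hMpos : 0 < M := hm₀.trans_le hM
    have : χ * M < 0 := mul_neg_of_neg_of_pos (not_le.mp hχ0) hMpos
    linarith [abs_nonneg a]

end Summit.FinalStateConjecture.FinalStateConjecture.Theorems

end
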